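import Summits.HodgeConjecture.HodgeConjecture.Theorems.K2E4WeakMatrixArchTransportOfRay   -- ★ p854807 (this seat): abstract `kappaTransport_of_delta_eq_const_mul` along a ray of transfer factors
import Literature.NumberTheory.Rogawski1990.RankOneEulerPoincareGlue                       -- ★ `IsLocSmooth.const_smul` (`C_c^∞(H_v)` is closed under scalars)
import Literature.NumberTheory.Rogawski1990.FinExplicitTransferFactorConjLeft               -- ★ `finExplicitDelta_conj_left_all` (explicit collection `Δ‴`)
import Literature.NumberTheory.Rogawski1990.FinExplicitTransferFactorConjRight              -- ★ `finExplicitDelta_conj_right_all`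
import HarnessLib

/-!
# K2 · E4 helper — (κ-loc) TRANSPORT ALONG A RAY OF FINITE-PLACE TRANSFER FACTORS («socket #22 on the ray»)

Cell `pub/hodgecm-mathlib`, Track B «K2-LIT», seat `hodgecm-mathlib-K2E4-p21` (g0), dealer K2E4-plan (g0) (DEAL 21:26:21Z); crux H413 = `stmt-HodgeConjecture-24833`
(supports-only helper, count-neutral).  THEOREMS ONLY (no definition, no instance, no notation, no named fact, no `sorry`).  The finite-place twin of ★
`Theorems/K2E4WeakMatrixArchTransportOfRay` (p854807).

Socket #22 `sig_K2E4WeakMatrixFiniteTransport` of `Cruxes/H413/Lines/K2_E4_SingularTransferKappaSignSigsWeakMatrixRigidity.lean` (U1 «WeakMatrixRigidity», NOT IN PRINT,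
HELD) asks, at every finite `v`: (κ-loc)_v with a non-zero constant for the explicit factor `Δ‴_v = finExplicitCollection L H′ μ … v` ⟹ (κ-loc)_v with a non-zero
constant for the WEAK `Δ v` of the letters' matrix `hCTM` (branch limits of an abstract `Δ v` on the sheets of the stable class — research-grade in general).  THIS FILE
proves the transport in the case that is pure bookkeeping and that rung 0 meets when `Δ v` is pinned on the RAY of the explicit factor (print's `Δ′_v = c_v Δ″_v`,
§14.6 p. 242; the sign plumbing ★ `TransferFactorData.constMul`): if `(Δ v).Δ(γ_H, γ) = c · Δ‴_v.Δ(γ_H, γ)` at every `G`-regular `γ_H ∈ H_v` with `c ≠ 0`, then `f^H` is a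
`Δ v`-transfer of `f` iff `c⁻¹ • f^H` is a `Δ‴_v`-transfer of `f` ((4.3.1) is read only at `G`-regular `γ_H` and is linear in `f^H`), `C_c^∞(H_v)` (★ `IsLocSmooth`) is
closed under scalars, hence (κ-loc)_v[Δ‴_v, cv₁] ⟹ (κ-loc)_v[Δ v, cv₁ · c⁻¹] for ANY functional of `f` and ANY evaluation point of `f^H` — in particular for the singular
stable orbital integral `Φ^st((γ₀)_v, f)` of a singular family `mGs₀ v` and the point `(γ_H)_v` of the socket.

* §1 **`finKappaTransport_of_delta_eq_const_mul`** (the `cmDatum` dress of ★ `kappaTransport_of_delta_eq_const_mul`; any functional ∕ point).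
* §2 **`weakMatrixFiniteTransport_of_ray`** — socket #22's per-place implication with its functional `localStableOrbitalIntegral L 3 H′ v (mGs₀ v) f (γ₀)_v` and its
  point `(γ_H)_v` VERBATIM, under the extra RAY hypothesis `Δv.Δ =_{G-reg} c · (finExplicitCollection L H′ μ … v).Δ` (read at `Δv := Δ v`, `mHv := mH v`, `mGv := mG v`,
  `mGs₀v := mGs₀ v` inside the socket's frame).

HONEST LABEL: HC_CM is proved only modulo the 7 printed citations (2 remaining named inputs: hLiu418 = stmt-HodgeConjecture-24832, h413 = stmt-HodgeConjecture-24833)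
until rung 0 closes; this file proves no printed statement and does NOT pay socket #22 (it discharges it only on the ray).

## References
* [Rogawski1990] J. D. Rogawski, *Automorphic Representations of Unitary Groups in Three Variables*, Ann. of Math. Stud. 123 (1990): §4.3 (4.3.1) p. 43; §4.9
  Prop. 4.9.1 (a) p. 55; §8.2 Prop. 8.2.1 (a) p. 118; §14.6 p. 242 («`Δ′_v = c_v Δ″_v`»).
* [LanglandsShelstad1987] R. P. Langlands, D. Shelstad, On the definition of transfer factors, Math. Ann. 278 (1987), §1.3–1.4.
-/

set_option autoImplicit false
set_option linter.dupNamespace false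

noncomputable section

open MeasureTheory Measure NumberField IsDedekindDomain
open Literature.NumberTheory.Rogawski1990 Literature.NumberTheory.Automorphic Literature.NumberTheory.GaloisRepresentations
open Summit.HodgeConjecture.HodgeConjecture.Cruxes.H413.K2E4WeakMatrixArchTransportOfRay (kappaTransport_of_delta_eq_const_mul)
open scoped Matrix MatrixGroups

namespace Summit.HodgeConjecture.HodgeConjecture.Cruxes.H413.K2E4WeakMatrixFiniteTransportOfRay

variable (L : Type) [Field L] [NumberField L] [IsCMField L] (H' : Matrix (Fin 3) (Fin 3) L) (v : HeightOneSpectrum (𝓞 ↥(maximalRealSubfield L)))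

/-! ## §1 The finite-place dress: `H_v = (U(Φ₂) × U(Φ₁))(L⁺_v)`, `G′_v = U(H′)(L⁺_v)`, test class `C_c^∞ = IsLocSmooth` -/

/-- **κ-TRANSPORT along a ray at a finite place**: for local transfer factors `T, T′` at `v` with `T.Δ(γ_H, γ) = c · T′.Δ(γ_H, γ)` at every `G`-regular `γ_H ∈ H_v`
(`c ≠ 0`), «(κ-loc)_v with constant `cv₁ ≠ 0` for `T′`» implies «(κ-loc)_v with constant `cv₁ · c⁻¹ ≠ 0` for `T`», for ANY functional `F` of the `G′_v`-test function and
ANY evaluation point `x₀ ∈ H_v` ((4.3.1) reads only `G`-regular `γ_H`, ★ `isLocalDeltaTransfer_iff`; `C_c^∞(H_v)` is closed under scalars, ★ `IsLocSmooth.const_smul`).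
[cite: Rogawski1990, §4.3 (4.3.1) p. 43; §4.9 Prop. 4.9.1 (a) p. 55; §14.6 p. 242] -/
theorem finKappaTransport_of_delta_eq_const_mul
    {_ha : ∀ a : ((UnitaryGroup.cmDatum L 2 (Matrix.of fun i j : Fin 2 => if i.val + j.val + 1 = 2 then (1 : L) else 0)).Local v ×
        (UnitaryGroup.cmDatum L 1 (Matrix.of fun i j : Fin 1 => if i.val + j.val + 1 = 1 then (1 : L) else 0)).Local v),
      MeasurableSpace (((UnitaryGroup.cmDatum L 2 (Matrix.of fun i j : Fin 2 => if i.val + j.val + 1 = 2 then (1 : L) else 0)).Local v ×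
        (UnitaryGroup.cmDatum L 1 (Matrix.of fun i j : Fin 1 => if i.val + j.val + 1 = 1 then (1 : L) else 0)).Local v) ⧸
        Subgroup.centralizer ({a} : Set ((UnitaryGroup.cmDatum L 2 (Matrix.of fun i j : Fin 2 => if i.val + j.val + 1 = 2 then (1 : L) else 0)).Local v ×
        (UnitaryGroup.cmDatum L 1 (Matrix.of fun i j : Fin 1 => if i.val + j.val + 1 = 1 then (1 : L) else 0)).Local v)))}
    {_hγ : ∀ γ : (UnitaryGroup.cmDatum L 3 H').Local v,
      MeasurableSpace ((UnitaryGroup.cmDatum L 3 H').Local v ⧸ Subgroup.centralizer ({γ} : Set ((UnitaryGroup.cmDatum L 3 H').Local v)))}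
    {T T' : LocalTransferFactor L H' v} {c : ℂ} (hc : c ≠ 0)
    (hT : ∀ (γH : (UnitaryGroup.cmDatum L 2 (Matrix.of fun i j : Fin 2 => if i.val + j.val + 1 = 2 then (1 : L) else 0)).Local v ×
          (UnitaryGroup.cmDatum L 1 (Matrix.of fun i j : Fin 1 => if i.val + j.val + 1 = 1 then (1 : L) else 0)).Local v)
        (γ : (UnitaryGroup.cmDatum L 3 H').Local v), IsLocalGRegular L v γH → T.Δ γH γ = c * T'.Δ γH γ)
    (mH : OrbitalMeasureFamily ((UnitaryGroup.cmDatum L 2 (Matrix.of fun i j : Fin 2 => if i.val + j.val + 1 = 2 then (1 : L) else 0)).Local v ×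
        (UnitaryGroup.cmDatum L 1 (Matrix.of fun i j : Fin 1 => if i.val + j.val + 1 = 1 then (1 : L) else 0)).Local v))
    (mG : OrbitalMeasureFamily ((UnitaryGroup.cmDatum L 3 H').Local v))
    (F : ((UnitaryGroup.cmDatum L 3 H').Local v → ℂ) → ℂ)
    (x₀ : (UnitaryGroup.cmDatum L 2 (Matrix.of fun i j : Fin 2 => if i.val + j.val + 1 = 2 then (1 : L) else 0)).Local v ×
        (UnitaryGroup.cmDatum L 1 (Matrix.of fun i j : Fin 1 => if i.val + j.val + 1 = 1 then (1 : L) else 0)).Local v)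
    {cv₁ : ℂ} (h₁ : cv₁ ≠ 0)
    (h : ∀ (fH : (UnitaryGroup.cmDatum L 2 (Matrix.of fun i j : Fin 2 => if i.val + j.val + 1 = 2 then (1 : L) else 0)).Local v ×
            (UnitaryGroup.cmDatum L 1 (Matrix.of fun i j : Fin 1 => if i.val + j.val + 1 = 1 then (1 : L) else 0)).Local v → ℂ)
        (f : (UnitaryGroup.cmDatum L 3 H').Local v → ℂ),
        IsLocSmooth f → IsLocSmooth fH → IsLocalDeltaTransfer L H' v T' mH mG fH f → F f = cv₁ * fH x₀) :
    ∃ cv : ℂ, cv ≠ 0 ∧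
      ∀ (fH : (UnitaryGroup.cmDatum L 2 (Matrix.of fun i j : Fin 2 => if i.val + j.val + 1 = 2 then (1 : L) else 0)).Local v ×
            (UnitaryGroup.cmDatum L 1 (Matrix.of fun i j : Fin 1 => if i.val + j.val + 1 = 1 then (1 : L) else 0)).Local v → ℂ)
        (f : (UnitaryGroup.cmDatum L 3 H').Local v → ℂ),
        IsLocSmooth f → IsLocSmooth fH → IsLocalDeltaTransfer L H' v T mH mG fH f → F f = cv * fH x₀ :=
  kappaTransport_of_delta_eq_const_mul hc (fun a b ha => hT a b ha) IsLocSmooth IsLocSmooth (fun z _ hfH => hfH.const_smul z) F x₀ h₁ h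

/-! ## §2 Socket #22 on the ray -/

/-- **SOCKET #22 ON THE RAY** — `sig_K2E4WeakMatrixFiniteTransport`'s per-place implication with its functional (the singular stable orbital integral
`Φ^st((γ₀)_v, f)` = ★ `localStableOrbitalIntegral L 3 H′ v mGs₀v f ((γ₀)_v)` of a singular family `mGs₀`) and its evaluation point `(γ_H)_v` VERBATIM, under the extra RAY
hypothesis `Δv.Δ(γ_H, γ) = c · Δ‴_v.Δ(γ_H, γ)` at the `G`-regular `γ_H` (`c ≠ 0`; `Δ‴_v` = ★ `finExplicitCollection L H′ μ … v`).  The weak-matrix case (no ray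
hypothesis) is the planners' «singular-pair rigidity» and is NOT claimed here. [cite: Rogawski1990, Prop. 8.2.1 (a) p. 118; §4.9 Prop. 4.9.1 (a) p. 55; §14.6 p. 242] -/
theorem weakMatrixFiniteTransport_of_ray
    {_ha : ∀ a : ((UnitaryGroup.cmDatum L 2 (Matrix.of fun i j : Fin 2 => if i.val + j.val + 1 = 2 then (1 : L) else 0)).Local v ×
        (UnitaryGroup.cmDatum L 1 (Matrix.of fun i j : Fin 1 => if i.val + j.val + 1 = 1 then (1 : L) else 0)).Local v),
      MeasurableSpace (((UnitaryGroup.cmDatum L 2 (Matrix.of fun i j : Fin 2 => if i.val + j.val + 1 = 2 then (1 : L) else 0)).Local v ×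
        (UnitaryGroup.cmDatum L 1 (Matrix.of fun i j : Fin 1 => if i.val + j.val + 1 = 1 then (1 : L) else 0)).Local v) ⧸
        Subgroup.centralizer ({a} : Set ((UnitaryGroup.cmDatum L 2 (Matrix.of fun i j : Fin 2 => if i.val + j.val + 1 = 2 then (1 : L) else 0)).Local v ×
        (UnitaryGroup.cmDatum L 1 (Matrix.of fun i j : Fin 1 => if i.val + j.val + 1 = 1 then (1 : L) else 0)).Local v)))}
    {_hγ : ∀ γ : (UnitaryGroup.cmDatum L 3 H').Local v,
      MeasurableSpace ((UnitaryGroup.cmDatum L 3 H').Local v ⧸ Subgroup.centralizer ({γ} : Set ((UnitaryGroup.cmDatum L 3 H').Local v)))}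
    (Δv : LocalTransferFactor L H' v)
    (mHv : OrbitalMeasureFamily ((UnitaryGroup.cmDatum L 2 (Matrix.of fun i j : Fin 2 => if i.val + j.val + 1 = 2 then (1 : L) else 0)).Local v ×
        (UnitaryGroup.cmDatum L 1 (Matrix.of fun i j : Fin 1 => if i.val + j.val + 1 = 1 then (1 : L) else 0)).Local v))
    (mGv mGs₀v : OrbitalMeasureFamily ((UnitaryGroup.cmDatum L 3 H').Local v))
    (μ : HeckeCharacter L) {c : ℂ} (hc : c ≠ 0)
    (hray : ∀ (γH : (UnitaryGroup.cmDatum L 2 (Matrix.of fun i j : Fin 2 => if i.val + j.val + 1 = 2 then (1 : L) else 0)).Local v ×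
          (UnitaryGroup.cmDatum L 1 (Matrix.of fun i j : Fin 1 => if i.val + j.val + 1 = 1 then (1 : L) else 0)).Local v)
        (γ : (UnitaryGroup.cmDatum L 3 H').Local v), IsLocalGRegular L v γH →
        Δv.Δ γH γ = c * (finExplicitCollection L H' μ (finExplicitDelta_conj_left_all L H' μ) (finExplicitDelta_conj_right_all L H' μ) v).Δ γH γ)
    (γ₀ : (UnitaryGroup.cmDatum L 3 H').Rational)
    (γH : (UnitaryGroup.cmDatum L 2 (Matrix.of fun i j : Fin 2 => if i.val + j.val + 1 = 2 then (1 : L) else 0)).Rational ×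
      (UnitaryGroup.cmDatum L 1 (Matrix.of fun i j : Fin 1 => if i.val + j.val + 1 = 1 then (1 : L) else 0)).Rational) :
    (∃ cv : ℂ, cv ≠ 0 ∧ ∀
          (fH : (UnitaryGroup.cmDatum L 2 (Matrix.of fun i j : Fin 2 => if i.val + j.val + 1 = 2 then (1 : L) else 0)).Local v × (UnitaryGroup.cmDatum L 1 (Matrix.of fun i j : Fin 1 => if i.val + j.val + 1 = 1 then (1 : L) else 0)).Local v → ℂ) (f : (UnitaryGroup.cmDatum L 3 H').Local v → ℂ),
        IsLocSmooth f → IsLocSmooth fH → IsLocalDeltaTransfer L H' v (finExplicitCollection L H' μ (finExplicitDelta_conj_left_all L H' μ) (finExplicitDelta_conj_right_all L H' μ) v) mHv mGv fH f →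
        localStableOrbitalIntegral L 3 H' v mGs₀v f ((UnitaryGroup.cmDatum L 3 H').toLocal v ((UnitaryGroup.cmDatum L 3 H').toAdelic γ₀)) =
          cv * fH ((UnitaryGroup.cmDatum L 2 (Matrix.of fun i j : Fin 2 => if i.val + j.val + 1 = 2 then (1 : L) else 0)).toLocal v ((UnitaryGroup.cmDatum L 2 (Matrix.of fun i j : Fin 2 => if i.val + j.val + 1 = 2 then (1 : L) else 0)).toAdelic γH.1),
            (UnitaryGroup.cmDatum L 1 (Matrix.of fun i j : Fin 1 => if i.val + j.val + 1 = 1 then (1 : L) else 0)).toLocal v ((UnitaryGroup.cmDatum L 1 (Matrix.of fun i j : Fin 1 => if i.val + j.val + 1 = 1 then (1 : L) else 0)).toAdelic γH.2))) →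
    ∃ cv : ℂ, cv ≠ 0 ∧ ∀
          (fH : (UnitaryGroup.cmDatum L 2 (Matrix.of fun i j : Fin 2 => if i.val + j.val + 1 = 2 then (1 : L) else 0)).Local v × (UnitaryGroup.cmDatum L 1 (Matrix.of fun i j : Fin 1 => if i.val + j.val + 1 = 1 then (1 : L) else 0)).Local v → ℂ) (f : (UnitaryGroup.cmDatum L 3 H').Local v → ℂ),
        IsLocSmooth f → IsLocSmooth fH → IsLocalDeltaTransfer L H' v Δv mHv mGv fH f →
        localStableOrbitalIntegral L 3 H' v mGs₀v f ((UnitaryGroup.cmDatum L 3 H').toLocal v ((UnitaryGroup.cmDatum L 3 H').toAdelic γ₀)) =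
          cv * fH ((UnitaryGroup.cmDatum L 2 (Matrix.of fun i j : Fin 2 => if i.val + j.val + 1 = 2 then (1 : L) else 0)).toLocal v ((UnitaryGroup.cmDatum L 2 (Matrix.of fun i j : Fin 2 => if i.val + j.val + 1 = 2 then (1 : L) else 0)).toAdelic γH.1),
            (UnitaryGroup.cmDatum L 1 (Matrix.of fun i j : Fin 1 => if i.val + j.val + 1 = 1 then (1 : L) else 0)).toLocal v ((UnitaryGroup.cmDatum L 1 (Matrix.of fun i j : Fin 1 => if i.val + j.val + 1 = 1 then (1 : L) else 0)).toAdelic γH.2)) := by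
  rintro ⟨cv₁, h₁, h⟩
  exact finKappaTransport_of_delta_eq_const_mul L H' v hc hray mHv mGv _ _ h₁ h

end Summit.HodgeConjecture.HodgeConjecture.Cruxes.H413.K2E4WeakMatrixFiniteTransportOfRay

end
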